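import Summits.RiemannHypothesis.RiemannHypothesis.Theses.WeilSemilocal
import Summits.RiemannHypothesis.RiemannHypothesis.Theorems.ThetaTier1ChebBridgeMain
import Summits.RiemannHypothesis.RiemannHypothesis.Theorems.WeilColumnThetaUCCheb
import Summits.RiemannHypothesis.RiemannHypothesis.Theorems.ThetaTier1Cover
import Summits.RiemannHypothesis.RiemannHypothesis.Theorems.ThetaTier1ChebRowsTenK01
import Summits.RiemannHypothesis.RiemannHypothesis.Theorems.ThetaTier1ChebRowsTenK02
import Summits.RiemannHypothesis.RiemannHypothesis.Theorems.ThetaTier1ChebRowsTenK03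
import Summits.RiemannHypothesis.RiemannHypothesis.Theorems.ThetaTier1ChebRowsTenK04
import Summits.RiemannHypothesis.RiemannHypothesis.Theorems.ThetaTier1ChebRowsTenK05
import Summits.RiemannHypothesis.RiemannHypothesis.Theorems.ThetaTier1ChebRowsTenK06
import Summits.RiemannHypothesis.RiemannHypothesis.Theorems.ThetaTier1ChebRowsTenK07
import HarnessLib

/-!
# Route `WeilSemilocal` — CLOSER of the crux `WallsTenKNonTwin` (item stmt-RiemannHypothesis-19173; RH-FREE)

FIN of the tier-1 theta certificate (WALLS-I, gap class `≥ 4`): for every prime `157 ≤ q < 10⁴` with `q + 2` composite and every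
prime `q' > q`, `a*(S_q) = weilSemilocalThreshold (Nat.primesBelow q) < (log q')/2`.  Composition, per kernel row
`r = (q, q⁺, 4, δ·10¹², k)` of the 7 data modules `ThetaTier1ChebRowsTenK01 … ThetaTier1ChebRowsTenK07` (1000 rows, 25 chunks):

* DATA (cc-s2-1 gen21, kernel `decide`): `_check : checkAllCheb rows = true` and `_facts' : ∀ r ∈ rows, r.m = 4 ∧ 2 ≤ r.q ∧
  Handoff.ConsecutivePrimes r.q r.qn`;
* (AR) `ThetaTier1.lossCheb_lt_gain_of_checkAllCheb_four` (p438258; RS-free, hypothesis-free): `(ofRow r).Admissible r.qn ∧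
  e² ≤ chebN ∧ lossCheb (2^-k) < gain 16`;
* (AN) `ThetaParams.ucCheb_of_lossCheb_lt_gain` (weil-1, p437152; Mathlib's Chebyshev bound, no named fact):
  `weilSemilocalThreshold (Nat.primesBelow q) < (log q⁺)/2`;
* `q⁺ ≤ q'` for every prime `q' > q` (`ConsecutivePrimes`), monotonicity of `log`;
* COVERAGE `ThetaTier1.tenK_cover` (p430282/p434229): every such `q` is listed in `tenKQs`, and `tenKQs = rows.map Row.q` (kernel).

UPPER clauses of truncated Weil forms only (LADDER-RH W-P(P2), cell `rh-explicit`, typing lane cc-s2-1 gen22); nothing here bears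
on the truth of RH.
-/

set_option linter.dupNamespace false  -- the mandated namespace repeats `RiemannHypothesis`
set_option autoImplicit false

namespace Summit.RiemannHypothesis.RiemannHypothesis.Theorems.WeilSemilocalRoute

open Summit.RiemannHypothesis.RiemannHypothesis.Theorems Summit.RiemannHypothesis.RiemannHypothesis.Theorems.ThetaTier1
open Summit.RiemannHypothesis.RiemannHypothesis.Theorems.WeilColumn.ThetaMellin
open Summit.RiemannHypothesis.RiemannHypothesis.Theorems.MotivicDoor.SemilocalThreshold

/-- **(AR) ∘ (AN) per row (WALLS-I)**: a row of a chunk certified by `checkAllCheb`, with `m = 4`, `2 ≤ q` and `q < q⁺` consecutive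
primes, has `a*(S_q) < (log q⁺)/2` (`UC(q)`). [this cell; composition of p438258 (cc-s2-1) and p437152 (weil-1)] -/
theorem tenK_uc_of_checkAllCheb (r : Row) {rows : List Row} (h : checkAllCheb rows = true) (hr : r ∈ rows)
    (hm : r.m = 4) (hq : 2 ≤ r.q) (hcons : Handoff.ConsecutivePrimes r.q r.qn) :
    weilSemilocalThreshold (Nat.primesBelow (ofRow r).q) < Real.log r.qn / 2 := by
  obtain ⟨hP, hN, hlg⟩ := lossCheb_lt_gain_of_checkAllCheb_four h r hr hm hq
  have h1 : (0 : ℝ) < 1 / 2 ^ r.k := by positivity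
  have h2 : (1 : ℝ) / 2 ^ r.k ≤ 1 := by
    rw [one_div]; exact inv_le_one_of_one_le₀ (one_le_pow₀ (by norm_num))
  have h3 : 0 < JSTEPS := by decide
  exact ThetaParams.ucCheb_of_lossCheb_lt_gain hP hcons hN h1 h2 h3 hlg

/-- From `UC(q)` to the route's clause: `a*(S_q) < (log q')/2` for every prime `q' > q`, since `q⁺ ≤ q'`. [folklore] -/
theorem tenK_wall_of_uc (r : Row) (hcons : Handoff.ConsecutivePrimes r.q r.qn)
    (huc : weilSemilocalThreshold (Nat.primesBelow (ofRow r).q) < Real.log r.qn / 2) :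
    ∀ q' : ℕ, q'.Prime → r.q < q' → weilSemilocalThreshold (Nat.primesBelow r.q) < Real.log q' / 2 := by
  intro q' hq' hlt
  rw [ofRow_q] at huc
  obtain ⟨-, hqn, -, hmin⟩ := hcons
  have hle : (r.qn : ℝ) ≤ q' := by exact_mod_cast hmin q' hq' hlt
  have h0 : (0 : ℝ) < r.qn := by exact_mod_cast hqn.pos
  have hlog := Real.log_le_log h0 hle
  linarith

/-- **FIN per chunk (WALLS-I)**: a chunk certified by `checkAllCheb` whose rows have `m = 4`, `2 ≤ q` and `q < q⁺` consecutive primes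
(the data modules' `_check` / `_facts'`) gives the route's clause at every row. [this cell] -/
theorem tenKRows_wall_of_checkAllCheb {rows : List Row} (h : checkAllCheb rows = true)
    (hf : ∀ r ∈ rows, r.m = 4 ∧ 2 ≤ r.q ∧ Handoff.ConsecutivePrimes r.q r.qn) :
    ∀ r ∈ rows, ∀ q' : ℕ, q'.Prime → r.q < q' → weilSemilocalThreshold (Nat.primesBelow r.q) < Real.log q' / 2 := by
  intro r hr
  obtain ⟨hm, hq, hcons⟩ := hf r hr
  exact tenK_wall_of_uc r hcons (tenK_uc_of_checkAllCheb r h hr hm hq hcons)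

/-- The coverage list `tenKQs` IS the list of abscissae of the 25 data chunks, in order (kernel). [this cell] -/
theorem tenKQs_eq_map_rows :
    tenKQs = (thetaTier1ChebRowsTenK01_1 ++ thetaTier1ChebRowsTenK01_2 ++ thetaTier1ChebRowsTenK01_3 ++ thetaTier1ChebRowsTenK01_4
      ++ thetaTier1ChebRowsTenK02_1 ++ thetaTier1ChebRowsTenK02_2 ++ thetaTier1ChebRowsTenK02_3 ++ thetaTier1ChebRowsTenK02_4
      ++ thetaTier1ChebRowsTenK03_1 ++ thetaTier1ChebRowsTenK03_2 ++ thetaTier1ChebRowsTenK03_3 ++ thetaTier1ChebRowsTenK03_4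
      ++ thetaTier1ChebRowsTenK04_1 ++ thetaTier1ChebRowsTenK04_2 ++ thetaTier1ChebRowsTenK04_3 ++ thetaTier1ChebRowsTenK04_4
      ++ thetaTier1ChebRowsTenK05_1 ++ thetaTier1ChebRowsTenK05_2 ++ thetaTier1ChebRowsTenK05_3 ++ thetaTier1ChebRowsTenK05_4
      ++ thetaTier1ChebRowsTenK06_1 ++ thetaTier1ChebRowsTenK06_2 ++ thetaTier1ChebRowsTenK06_3 ++ thetaTier1ChebRowsTenK06_4
      ++ thetaTier1ChebRowsTenK07_1).map Row.q := by
  decide +kernel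

/-- **C-I(a) at every listed abscissa**: for `q ∈ tenKQs` and every prime `q' > q`, `a*(S_q) < (log q')/2`. [this cell] -/
theorem tenK_walls : ∀ q ∈ tenKQs, ∀ q' : ℕ, q'.Prime → q < q' →
    weilSemilocalThreshold (Nat.primesBelow q) < Real.log q' / 2 := by
  rw [tenKQs_eq_map_rows]
  simp only [List.map_append, List.forall_mem_append, List.forall_mem_map, and_assoc]
  exact ⟨tenKRows_wall_of_checkAllCheb thetaTier1ChebRowsTenK01_1_check thetaTier1ChebRowsTenK01_1_facts',
    tenKRows_wall_of_checkAllCheb thetaTier1ChebRowsTenK01_2_check thetaTier1ChebRowsTenK01_2_facts',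
    tenKRows_wall_of_checkAllCheb thetaTier1ChebRowsTenK01_3_check thetaTier1ChebRowsTenK01_3_facts',
    tenKRows_wall_of_checkAllCheb thetaTier1ChebRowsTenK01_4_check thetaTier1ChebRowsTenK01_4_facts',
    tenKRows_wall_of_checkAllCheb thetaTier1ChebRowsTenK02_1_check thetaTier1ChebRowsTenK02_1_facts',
    tenKRows_wall_of_checkAllCheb thetaTier1ChebRowsTenK02_2_check thetaTier1ChebRowsTenK02_2_facts',
    tenKRows_wall_of_checkAllCheb thetaTier1ChebRowsTenK02_3_check thetaTier1ChebRowsTenK02_3_facts',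
    tenKRows_wall_of_checkAllCheb thetaTier1ChebRowsTenK02_4_check thetaTier1ChebRowsTenK02_4_facts',
    tenKRows_wall_of_checkAllCheb thetaTier1ChebRowsTenK03_1_check thetaTier1ChebRowsTenK03_1_facts',
    tenKRows_wall_of_checkAllCheb thetaTier1ChebRowsTenK03_2_check thetaTier1ChebRowsTenK03_2_facts',
    tenKRows_wall_of_checkAllCheb thetaTier1ChebRowsTenK03_3_check thetaTier1ChebRowsTenK03_3_facts',
    tenKRows_wall_of_checkAllCheb thetaTier1ChebRowsTenK03_4_check thetaTier1ChebRowsTenK03_4_facts',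
    tenKRows_wall_of_checkAllCheb thetaTier1ChebRowsTenK04_1_check thetaTier1ChebRowsTenK04_1_facts',
    tenKRows_wall_of_checkAllCheb thetaTier1ChebRowsTenK04_2_check thetaTier1ChebRowsTenK04_2_facts',
    tenKRows_wall_of_checkAllCheb thetaTier1ChebRowsTenK04_3_check thetaTier1ChebRowsTenK04_3_facts',
    tenKRows_wall_of_checkAllCheb thetaTier1ChebRowsTenK04_4_check thetaTier1ChebRowsTenK04_4_facts',
    tenKRows_wall_of_checkAllCheb thetaTier1ChebRowsTenK05_1_check thetaTier1ChebRowsTenK05_1_facts',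
    tenKRows_wall_of_checkAllCheb thetaTier1ChebRowsTenK05_2_check thetaTier1ChebRowsTenK05_2_facts',
    tenKRows_wall_of_checkAllCheb thetaTier1ChebRowsTenK05_3_check thetaTier1ChebRowsTenK05_3_facts',
    tenKRows_wall_of_checkAllCheb thetaTier1ChebRowsTenK05_4_check thetaTier1ChebRowsTenK05_4_facts',
    tenKRows_wall_of_checkAllCheb thetaTier1ChebRowsTenK06_1_check thetaTier1ChebRowsTenK06_1_facts',
    tenKRows_wall_of_checkAllCheb thetaTier1ChebRowsTenK06_2_check thetaTier1ChebRowsTenK06_2_facts',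
    tenKRows_wall_of_checkAllCheb thetaTier1ChebRowsTenK06_3_check thetaTier1ChebRowsTenK06_3_facts',
    tenKRows_wall_of_checkAllCheb thetaTier1ChebRowsTenK06_4_check thetaTier1ChebRowsTenK06_4_facts',
    tenKRows_wall_of_checkAllCheb thetaTier1ChebRowsTenK07_1_check thetaTier1ChebRowsTenK07_1_facts'⟩

/-- **CLOSER of the crux `WallsTenKNonTwin`** (item stmt-RiemannHypothesis-19173, `route-RiemannHypothesis-WeilSemilocal`): C-I(a) at every
prime `157 ≤ q < 10⁴` of gap `≥ 4`. [this cell; tier-1 theta certificate, (AR) p438258 ∘ (AN) p437152 over 1000 kernel rows] -/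
theorem wallsTenKNonTwin_proof :
    Summit.RiemannHypothesis.RiemannHypothesis.Theses.WeilSemilocal.WallsTenKNonTwin := by
  unfold Theses.WeilSemilocal.WallsTenKNonTwin
  intro q hq hlo hhi hn
  exact tenK_walls q (tenK_cover q hlo hhi hq hn)

end Summit.RiemannHypothesis.RiemannHypothesis.Theorems.WeilSemilocalRoute
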